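import Summits.Ventures.Crystal3D.Theorems.StickyWulffConstantGenericWallFloorBarlowPrefix
import Summits.Ventures.Crystal3D.Theorems.StickyWulffConstantTextureLiminfFluxPolyline
import HarnessLib

/-!
# The walk machine's zigzag step selector satisfies lane T's `zigStep_spec` (rise = `bilayerRise`, unit, height `√(2/3)`)
# (crux `GenericWallFloor`, stmt-Ventures-19480, line `WallLedgerG`; G-side half of lane T's F4 — cf-p1 15:54:39Z ruling:
# «F4 instantiates step := machine selector and supplies the three properties»)

HONEST FRAMING. Venture `Summits/Ventures/Crystal3D` (cell `crystal3d-full`), helper `--supports` the crux `GenericWallFloor`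
(stmt-Ventures-19480) of `route-Ventures-StickyWulffConstant`, registered line `WallLedgerG`, open stub `stub_twoSlabAdhesion`.
Rung credit only; F-C1 not moved; NOT the stub.

Lane T's flux count (`…TextureLiminfFlux*`, wulff-p2) is being restated over an ABSTRACT step selector `step` with the three
properties of `zigStep_spec`: `⟪step, L⁻¹e⟫ = bilayerRise`, `‖step‖ = 1`, `step₂ = axisSign·√(2/3)`.  The walkers' actual steps are
the MACHINE's: on a Δ-bilayer the family slot `v₀`, on a ∇-bilayer `basalMirror q` with `q = bestCapper G (L e₃) e` chosen by
`pushMove` (`Classical.choose` of an argmax) — the same maximised functional as T's `modelStep` but possibly another argmax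
under ties.  This file proves the three properties for the machine selector in the orientation `axisSign = +1`
(`0 ≤ (L⁻¹e)₂`, layer index increasing toward `e`), with the family slot `v₀ := best3 (⟪·, L⁻¹e⟫) upSlot₁ upSlot₂ upSlot₃`:

* `eq_upSlot_of_apply_two` — a slot of model height `√(2/3)` is one of the three reference upper slots;
* `familySlot_spec` — `v₀ ∈ fccSlots`, `v₀ ₂ = √(2/3)`, and on every Δ-bilayer `v₀ = bestUpSlot` and `⟪v₀, L⁻¹e⟫ = bilayerRise`;
* `inner_basalMirror_bestCapper` — on every ∇-bilayer `⟪basalMirror q, L⁻¹e⟫ = bilayerRise` (argmax VALUES agree);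
* **`machineStep_spec`** — for `ms m = v₀` (`σ m = 1`) / `basalMirror q` (`σ m = −1`): the three `zigStep_spec` properties.
WHAT THIS IS NOT: the `axisSign = −1` orientation (reverse the word / compose `L` with the basal mirror — F4's bookkeeping);
no count; F-C1 not moved.
-/

noncomputable section

namespace Summit.Ventures.Crystal3D.Theorems

open Finset
open Literature.MathematicalPhysics.StatisticalMechanics
open Summit.Ventures.Crystal3D.Cruxes.TextureLiminf.TexShadow (upSlot₁ upSlot₂ upSlot₃ bondRise bilayerRise)
open scoped InnerProductSpace

/-- A slot of model height `√(2/3)` is one of the three reference upper slots. -/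
theorem eq_upSlot_of_apply_two {w : EuclideanSpace ℝ (Fin 3)} (hw : w ∈ fccSlots) (h2 : w 2 = Real.sqrt (2 / 3)) :
    w = upSlot₁ ∨ w = upSlot₂ ∨ w = upSlot₃ := by
  classical
  have hrpos : 0 < Real.sqrt (2 / 3) := Real.sqrt_pos.2 (by norm_num)
  rw [fccSlots, Finset.mem_image] at hw
  obtain ⟨c, hc, rfl⟩ := hw
  rw [barlowPos_apply_two] at h2
  simp only [fccSlotTriples, Finset.mem_insert, Finset.mem_singleton] at hc
  rcases hc with rfl | rfl | rfl | rfl | rfl | rfl | rfl | rfl | rfl | rfl | rfl | rfl <;>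
    first
    | exact Or.inl rfl
    | exact Or.inr (Or.inl rfl)
    | exact Or.inr (Or.inr rfl)
    | (exfalso; dsimp only at h2; push_cast at h2; ring_nf at h2; linarith)

/-- `⟪L y, e⟫ = ⟪y, L⁻¹ e⟫`. -/
theorem inner_map_eq_inner_symm (L : EuclideanSpace ℝ (Fin 3) ≃ₗᵢ[ℝ] EuclideanSpace ℝ (Fin 3)) (y e : EuclideanSpace ℝ (Fin 3)) :
    ⟪L y, e⟫_ℝ = ⟪y, L.symm e⟫_ℝ := by
  rw [← LinearIsometryEquiv.inner_map_map L y (L.symm e), LinearIsometryEquiv.apply_symm_apply]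

section Oriented

variable (σ : ℤ → ℤ) (L : EuclideanSpace ℝ (Fin 3) ≃ₗᵢ[ℝ] EuclideanSpace ℝ (Fin 3)) (e v₀ : EuclideanSpace ℝ (Fin 3))

/-- **The family slot.**  With `v₀ := best3 (⟪·, L⁻¹e⟫) upSlot₁ upSlot₂ upSlot₃` and `0 ≤ (L⁻¹e)₂`: `v₀` is an upper slot, it IS
lane T's `bestUpSlot` on every Δ-bilayer, and its rise is `bilayerRise` there. -/
theorem familySlot_spec (hax : 0 ≤ (L.symm e) 2)
    (hv₀ : v₀ = best3 (fun w => ⟪w, L.symm e⟫_ℝ) upSlot₁ upSlot₂ upSlot₃) :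
    v₀ ∈ fccSlots ∧ v₀ 2 = Real.sqrt (2 / 3) ∧
      ∀ m : ℤ, σ m = 1 → bestUpSlot L σ e m = v₀ ∧ ⟪v₀, L.symm e⟫_ℝ = bilayerRise L σ e m := by
  obtain ⟨h1, h2, h3⟩ := upSlots_mem_fccSlots
  have hmem : v₀ ∈ fccSlots ∧ v₀ 2 = Real.sqrt (2 / 3) := by
    rcases best3_mem (fun w => ⟪w, L.symm e⟫_ℝ) upSlot₁ upSlot₂ upSlot₃ with h | h | h <;> rw [hv₀, h]
    · exact ⟨h1, by simp [upSlot₁, barlowPos_apply_two]⟩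
    · exact ⟨h2, by simp [upSlot₂, barlowPos_apply_two]⟩
    · exact ⟨h3, by simp [upSlot₃, barlowPos_apply_two]⟩
  refine ⟨hmem.1, hmem.2, fun m hm => ?_⟩
  have hb : bondRise L σ e m = fun w => ⟪w, L.symm e⟫_ℝ := by
    funext w; simp [bondRise, hax, hm]
  refine ⟨by rw [bestUpSlot, hb, hv₀], ?_⟩
  have h := apply_best3 (fun w => ⟪w, L.symm e⟫_ℝ) upSlot₁ upSlot₂ upSlot₃
  rw [bilayerRise, hb, hv₀]
  beta_reduce at h ⊢
  exact h

/-- **The ∇-step's rise is `bilayerRise`.**  `q = bestCapper G (L e₃) e`, `G = twinFrame L (L e₃)`: on every ∇-bilayer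
`⟪basalMirror q, L⁻¹e⟫ = bilayerRise` (the machine's argmax and lane T's `best3` maximise the same three values). -/
theorem inner_basalMirror_bestCapper (hax : 0 ≤ (L.symm e) 2) (m : ℤ) (hm : σ m = -1) :
    ⟪basalMirror (bestCapper (twinFrame L (L (EuclideanSpace.single (2 : Fin 3) (1 : ℝ))))
        (L (EuclideanSpace.single (2 : Fin 3) (1 : ℝ))) e), L.symm e⟫_ℝ = bilayerRise L σ e m := by
  set e₃ : EuclideanSpace ℝ (Fin 3) := EuclideanSpace.single (2 : Fin 3) (1 : ℝ) with he₃
  set G := twinFrame L (L e₃) with hG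
  set q := bestCapper G (L e₃) e with hqdef
  obtain ⟨hq, hq2⟩ : q ∈ fccSlots ∧ q 2 = -Real.sqrt (2 / 3) := bestCapper_nabla_slot L e
  have hrpos : 0 < Real.sqrt (2 / 3) := Real.sqrt_pos.2 (by norm_num)
  have hm' : ¬ σ m = 1 := by rw [hm]; decide
  -- bondRise on a ∇-bilayer, and its geometric meaning
  have hb : ∀ w, bondRise L σ e m w = ⟪basalMirror (-w), L.symm e⟫_ℝ := by
    intro w
    simp only [bondRise, if_pos hax, if_neg hm', one_mul]
    rw [map_neg, inner_neg_left, ← inner_basalMirror_comm]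
  have hGe : ∀ x : EuclideanSpace ℝ (Fin 3), ⟪G x, e⟫_ℝ = ⟪basalMirror x, L.symm e⟫_ℝ := by
    intro x; rw [hG, twinFrame_axis_apply, inner_map_eq_inner_symm]
  -- the G-positive slots are the negatives of the upper slots
  have hpos_of_up : ∀ w ∈ fccSlots, w 2 = Real.sqrt (2 / 3) → -w ∈ fccSlots.filter fun q' => 0 < ⟪G q', L e₃⟫_ℝ := by
    intro w hw hw2
    refine Finset.mem_filter.2 ⟨neg_mem_fccSlots hw, ?_⟩
    rw [hG, twinFrame_axis_apply, inner_frame_axis, basalMirror_apply_coord]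
    simp only [if_true, PiLp.neg_apply, neg_neg, hw2]; exact hrpos
  have hne : (fccSlots.filter fun q' => 0 < ⟪G q', L e₃⟫_ℝ).Nonempty :=
    ⟨-upSlot₁, hpos_of_up _ upSlots_mem_fccSlots.1 (by simp [upSlot₁, barlowPos_apply_two])⟩
  obtain ⟨-, hmax⟩ := bestCapper_spec G (L e₃) e hne
  -- `≥`: each reference bond is dominated by the best capper
  have hle : ∀ w ∈ fccSlots, w 2 = Real.sqrt (2 / 3) → bondRise L σ e m w ≤ ⟪basalMirror q, L.symm e⟫_ℝ := by
    intro w hw hw2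
    rw [hb, ← hGe, ← hGe]
    exact hmax (-w) (hpos_of_up w hw hw2)
  obtain ⟨h1, h2, h3⟩ := upSlots_mem_fccSlots
  have hu1 : upSlot₁ 2 = Real.sqrt (2 / 3) := by simp [upSlot₁, barlowPos_apply_two]
  have hu2 : upSlot₂ 2 = Real.sqrt (2 / 3) := by simp [upSlot₂, barlowPos_apply_two]
  have hu3 : upSlot₃ 2 = Real.sqrt (2 / 3) := by simp [upSlot₃, barlowPos_apply_two]
  -- `≤`: the best capper is the negative of a reference upper slot
  have hnegq : -q = upSlot₁ ∨ -q = upSlot₂ ∨ -q = upSlot₃ :=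
    eq_upSlot_of_apply_two (neg_mem_fccSlots hq) (by simp [hq2])
  have hval : ⟪basalMirror q, L.symm e⟫_ℝ = bondRise L σ e m (-q) := by rw [hb, neg_neg]
  apply le_antisymm
  · rw [hval, bilayerRise]
    rcases hnegq with h | h | h <;> rw [h]
    · exact le_max_of_le_left (le_max_left _ _)
    · exact le_max_of_le_left (le_max_right _ _)
    · exact le_max_right _ _
  · rw [bilayerRise]
    exact max_le (max_le (hle _ h1 hu1) (hle _ h2 hu2)) (hle _ h3 hu3)

variable (ms : ℤ → EuclideanSpace ℝ (Fin 3))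

/-- **The machine's step selector satisfies `zigStep_spec`** (orientation `axisSign = +1`): rise `bilayerRise`, unit length,
model height `√(2/3)`, on every bilayer of a Hägg word. -/
theorem machineStep_spec (hσ : IsHaggSeq σ) (hax : 0 ≤ (L.symm e) 2)
    (hv₀ : v₀ = best3 (fun w => ⟪w, L.symm e⟫_ℝ) upSlot₁ upSlot₂ upSlot₃)
    (hms₁ : ∀ m, σ m = 1 → ms m = v₀)
    (hms₂ : ∀ m, σ m = -1 → ms m =
      basalMirror (bestCapper (twinFrame L (L (EuclideanSpace.single (2 : Fin 3) (1 : ℝ)))) (L (EuclideanSpace.single (2 : Fin 3) (1 : ℝ))) e))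
    (m : ℤ) :
    ⟪ms m, L.symm e⟫_ℝ = bilayerRise L σ e m ∧ ‖ms m‖ = 1 ∧ (ms m) 2 = Real.sqrt (2 / 3) := by
  obtain ⟨hv₀S, hv₀2, hΔ⟩ := familySlot_spec σ L e v₀ hax hv₀
  obtain ⟨hq, hq2⟩ := bestCapper_nabla_slot L e
  rcases hσ m with hm | hm
  · rw [hms₁ m hm]
    exact ⟨(hΔ m hm).2, norm_eq_one_of_mem_fccSlots hv₀S, hv₀2⟩
  · rw [hms₂ m hm]
    refine ⟨inner_basalMirror_bestCapper σ L e hax m hm, ?_, ?_⟩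
    · rw [LinearIsometryEquiv.norm_map, norm_eq_one_of_mem_fccSlots hq]
    · rw [basalMirror_apply_coord]; simp [hq2]

end Oriented

end Summit.Ventures.Crystal3D.Theorems

end
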